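import Summits.Langlands.Langlands.Theses.QuarterDeficit1951

/-!
# Disproof of `CorrespondentFingerprint` (stmt-Langlands-15898) — standing adversary file

Crux: `Summit.Langlands.Langlands.Theses.QuarterDeficit1951.CorrespondentFingerprint` (C2a of
route `QuarterDeficit1951`).  Disprover: refuter-cdisprove-stmt-Langlands-15898-0, cycle 1
(2026-08-16).  VERDICT SO FAR: **no kill**; the statement is almost certainly TRUE as typed, for a
reason that makes every hypothesis-dropping attack toothless (finding 1).

## Findings (each backed by a theorem below unless marked "paper")

1. **LOGICAL SHAPE — the conclusion is closed.**  The conclusion `MaassWitness` (an order-5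
   `χ mod 1951` and a non-zero weight-0 Maass cusp form on `(Γ₀(1951), χ)` with `λ = 1/4` and the
   exact icosahedral fingerprint at `p ≤ 13`) mentions none of `RD, ℓ, ι, π, ρ`.  Hence
   `CorrespondentFingerprint ↔ (HypInstance → MaassWitness)` (`correspondentFingerprint_iff`) and
   `¬ CorrespondentFingerprint ↔ HypInstance ∧ ¬ MaassWitness` (`not_correspondentFingerprint_iff`):
   ANY refutation must (a) produce a full all-places correspondent `(RD, ℓ, ι, π, ρ)` of an even
   icosahedral conductor-1951 representation AND (b) prove that NO fingerprinted `λ = 1/4` form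
   exists for ANY order-5 character.  (b) is believed FALSE (strong Artin for the four Doud–Moore
   representations predicts exactly these forms; Booker 2005 / Booker–Lee–Strömbergsson 2020 §5
   see them numerically), and (a) is the Langlands correspondence for that `ρ`.
   COROLLARY (load-bearing analysis): for EVERY weakening `CF⁻` of the hypotheses,
   `MaassWitness → CF⁻` (`weakening_of_maassWitness`), so no `_false_without_<H>` theorem is
   obtainable without refuting `MaassWitness`.  The hypotheses (`IsEven`, conductor `1951`,
   `IsLAlgebraic`, all-places `Corresponds`, `ℓ ≥ 17`, finite image, irreducibility) are
   load-bearing for the intended PROOF (archimedean pinning / level exactness / dictionary), not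
   for the truth value.  In particular the planner's "why it might fail" (conductor-blind LLC,
   non-unitary `π_∞`) CANNOT falsify the item as typed — it can only obstruct the proof.
2. **NO FINITE OR JUNK MODEL of the hypotheses** (paper, by reading the defs): `FramedGaloisRep`
   (= `Γ_ℚ →ₜ* GL₂`, Mathlib `Field.absoluteGaloisGroup`), `IsUnramifiedAt` (Mathlib
   `Ideal.inertia` over `primesAbove`), `HasFrobCharpolyAt` (Mathlib `IsArithFrobAt`),
   `artinConductorNat` (codim of inertia invariants + Swan integral, `finprod`), `IsEven`
   (`IsComplexConjugation`), `Corresponds` (conjunctive `∃`, fail-safe FALSE on unsatisfiable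
   interfaces), `LocalLanglandsDatum` (carries the six-clause `IsLocalLanglandsGL` proof) are all
   honest: a witness of `HypInstance` is a genuine `A₅`-extension of `ℚ` with Frobenius data at
   every prime plus an automorphic correspondent — nothing `decide`/small-model can touch.
   Degenerate parameters are all excluded by the statement itself (`ℓ ≥ 17` keeps `ℓ ∉ P₀`,
   `ℓ ≠ 1951`; `1951` prime; `P₀ ∌ 1951`).
3. **CROSS-CRUX TENSION (inside the closes cone).**  `MaassWitness → ¬ QuarterFingerprintDeficit`
   (`maassWitness_not_quarterFingerprintDeficit`: `λ = 1/4` is in the window and exact membership is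
   within `1/100`).  Hence `QuarterFingerprintDeficit → (CorrespondentFingerprint ↔ ¬ HypInstance)`
   (`correspondentFingerprint_iff_noCorrespondent_of_deficit`): MODULO THE ROUTE'S OWN BET, C2a is
   exactly the statement "no cuspidal L-algebraic `π` corresponds at all places, for any
   reciprocity data, to any even icosahedral conductor-1951 `ρ` with order-5 determinant" — the
   contrapositive of the intended chain.  Provers: under `h₁ : QuarterFingerprintDeficit` you may
   prove C2a by deriving `False` from a correspondent; without `h₁` you must BUILD the Maass form
   `u` from `π` (descent of a weight-0 `K₀(1951)`-vector), there is no third way.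
4. **PARITY TIGHTNESS of the conclusion's shape.**  `-1 ∈ Γ₀(1951)` acts trivially on `ℍ` with
   `d`-entry `-1`, so the weight-0 automorphy clause with an ODD character forces `u = 0`
   (`automorphy_odd_forces_zero`); the odd-nebentypus twin of `MaassWitness` is FALSE
   (`not_maassWitnessOdd`).  Order-5 characters are even (`even_of_orderOf_eq_five`), so the
   conclusion is consistent — but this is exactly where `ρ.IsEven` / the odd order of `det ρ` is
   consumed on the automorphic side: transplanting the typed conclusion to an odd `ρ` (where
   reciprocity IS known, weight-1 forms) gives a false statement by parity alone.
5. **Sign / normalisation audit of the conclusion** (paper): `hypLaplacian = y²(∂ₓ² + ∂_y²)`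
   (Iwaniec (1.19), Mathlib `Laplacian.laplacian`, no sign junk), so `Δu + ¼u = 0` is the honest
   `λ = 1/4` equation; `Tp` is the standard unitary-normalised `T_p` with nebentypus
   (`p^{-1/2}(Σ_b u((z+b)/p) + χ(p) u(pz))`); the fingerprint `μ_p² χ̄(p)` equals
   `(α+β)²/(αβ)`, invariant under `(α,β) ↦ (α⁻¹,β⁻¹)` and scalar twists, so neither the
   arithmetic/geometric Frobenius convention of `arithFrobPolyOfSatake` nor `χ` vs `χ⁻¹` in the
   `χ(d)` automorphy convention can break exact membership in `Φ` (both `χ₀`, `χ₀⁻¹` have order 5;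
   `Φ ⊂ ℝ` is conjugation-closed).  Cusp `0` has width `1951` and `S T^{1951} S⁻¹ ∈ Γ₀(1951)` has
   `d = 1`, so the second constant-term clause is well posed.  No typing junk found that would make
   `MaassWitness` provable (junk `u`) or refutable (sign).

## Attacks tried → outcome (cycle 1)
* elaboration probe (`probes/W.lean`): rc 0, one sorry; binders read back — OK.
* vacuity (hypotheses unsatisfiable by typing?): no — every clause is satisfiable in principle by
  the Doud–Moore datum; nothing provable either way in-tree (needs an `A₅` field). Not vacuous.
* triviality (`MaassWitness` by junk `u`): impossible — `IsC2` + honest Laplacian + `λ ≠ 0` force a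
  genuine real-analytic eigenfunction; constants fail the PDE, unbounded `y^s` fail boundedness.
* cheap falsity / small models: none exist (finding 2).
* hypothesis mutation: every drop is implied by `MaassWitness` (finding 1) — no bite possible.
* junk models of interfaces (`RD` adversarial): `LocalLanglandsDatum` requires an
  `IsLocalLanglandsGL` proof (bijective `rec_n`, LCFT at `n = 1`, ε/L of pairs) — no junk datum.
* negatives index / barrier catalogue: 1 Langlands negative (SerreTypeAnchor, prime-free-set
  typing) — pattern absent here (all prime sets explicit); barriers are construction-side, n/a.

## Landed negative knowledge (importable; `--supports stmt-Langlands-15898`)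
* `Summits/Langlands/Langlands/Theorems/CorrespondentFingerprint/Negative/RefutationShape.lean`
  (p128382, ACCEPTED): `not_correspondentFingerprint_iff`, `not_quarterFingerprintDeficit_of_witness`,
  `correspondentFingerprint_iff_noCorrespondent_of_deficit` (findings 1, 3; statements inlined).
* `Summits/Langlands/Langlands/Theorems/CorrespondentFingerprint/Negative/OddNebentypus.lean`
  (p128413, ACCEPTED): `eq_zero_of_weightZero_automorphy_odd`, `not_exists_weightZero_form_odd`,
  `even_of_orderOf_odd`, `even_of_orderOf_eq_five`, `even_of_weightZero_witness` (finding 4).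

## For the picked line `Sketch` (PICKED.md 2026-08-16) — pre-emptive notes, no stubs registered yet
* `barrier_eq_zero_of_pos` / `liouville_neg_eigenvalue`: TRUE (separation of variables: modes
  `y^s, y^{1-s}, √y K_ν, √y I_ν` are all unbounded on the strip when `s(s-1) = c > 0`; or maximum
  principle against `y^s + y^{1-s}` / the radial spherical function).  Not attackable.  TIGHT at
  `c = 0`: `u = e^{-2πy} cos(2πx)` is bounded, `1`-periodic, `C²`, harmonic, cuspidal at `∞` — and
  for every `λ = s(1-s) ≥ 0` the mode `√y K_{s-1/2}(2πy) cos(2πx)` is a bounded periodic solution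
  of `(Δ + λ)u = 0` (i.e. the lemma fails for every `c ≤ 0`); so boundedness + periodicity pin
  NOTHING on the `λ ≥ 0` side without the integrality
  `λ = 1/4 - a², a ∈ ℤ` supplied by `IsLAlgebraic` (load-bearing for the proof, finding 1).
* `exists_levelOne_fixed_of_natDegree_rsLFactor` (card B) — CHECKED, no bite: the feared
  non-generic model `π_v = μ ∘ det` (conductor-one `μ`, no `K₁(𝔭)`-fixed vector since
  `det K₁(𝔭) = 𝒪ˣ`) does NOT satisfy the hypotheses: `HasRSLFactor` clause (b)
  (`RankinSelbergLocal.lean:639`, "`1/P(q^{-s})` is a finite combination of zeta integrals")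
  fails when `whittakerFunctionals π ψ = {0}` (all zeta integrals vanish, while
  `evalAtQ q (rsLRat P) s ≠ 0` for `re s ≫ 0` as `P(0) = 1`).  Among generic irreducibles the two
  degree conditions leave only `PS(unramified, conductor-one)`, where the lemma is true.
* `isOfWeightZero_of_isLAlgebraic_of_even` (card 1, K2 sketch) — CHECKED, no junk `W = ⊥`:
  `AutomorphicRepData.lt : W' < W` forces `W / W' ≠ 0`.
* `recGL_unramified_at_ell`, `isSatakeParameter_of_recGL_unramified` (card 2, K2 sketch): not
  attacked this cycle (need the registered signatures; `hq` excludes the `q^{±1}` Steinberg ratio,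
  which the icosahedral data meet since `x₀/x₁` is a root of unity).
-/

noncomputable section

-- single-conjunct summit `Summits/Langlands/Langlands` (D-0017): the doubled namespace is the tree's layout
set_option linter.dupNamespace false

open scoped MatrixGroups
open Summit.Langlands Summit.Langlands.Langlands.Theses.QuarterDeficit1951
open Literature.NumberTheory.Automorphic Literature.NumberTheory.GaloisRepresentations

namespace Summit.Langlands.Langlands.Cruxes.CorrespondentFingerprint.Disproof

/-! ## The pieces of the crux, named (verbatim copies of the route file's `let`s) -/

/-- The fingerprint set `Φ = {0, 1, 4, (3 ± √5)/2}` of the route file. -/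
def Φ : Set ℂ := {0, 1, 4, (((3 + Real.sqrt 5) / 2 : ℝ) : ℂ), (((3 - Real.sqrt 5) / 2 : ℝ) : ℂ)}

/-- The test primes `P₀ = {2, 3, 5, 7, 11, 13}` of the route file. -/
def P₀ : Finset ℕ := {2, 3, 5, 7, 11, 13}

/-- `IsForm χ u lam` of the route file: `C²`, `(Δ + lam) u = 0`, weight-0 automorphy with
nebentypus `χ(d)` on `Γ₀(1951)`, vanishing constant terms at `∞` and at `0`, bounded. -/
def IsForm (χ : DirichletCharacter ℂ 1951) (u : UpperHalfPlane → ℂ) (lam : ℝ) : Prop :=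
  IsC2 u ∧ (∀ z, hypLaplacian u z + (lam : ℂ) * u z = 0) ∧
    (∀ γ : Matrix.SpecialLinearGroup (Fin 2) ℤ, γ ∈ CongruenceSubgroup.Gamma0 1951 →
      ∀ z : UpperHalfPlane, u (γ • z) = χ ((γ 1 1 : ℤ) : ZMod 1951) * u z) ∧
    (∀ y : ℝ, 0 < y → ∫ x in (0 : ℝ)..1, u (UpperHalfPlane.ofComplex (x + y * Complex.I)) = 0) ∧
    (∀ y : ℝ, 0 < y →
      ∫ x in (0 : ℝ)..1951, u (ModularGroup.S • UpperHalfPlane.ofComplex (x + y * Complex.I)) = 0) ∧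
    (∃ C : ℝ, ∀ z, ‖u z‖ ≤ C)

/-- The Hecke operator `T_p` of the route file (unitary normalisation, nebentypus `χ`). -/
def Tp (χ : DirichletCharacter ℂ 1951) (p : ℕ) (u : UpperHalfPlane → ℂ) (z : UpperHalfPlane) : ℂ :=
  ((Real.sqrt p : ℝ) : ℂ)⁻¹ *
    ((∑ b ∈ Finset.range p, u (UpperHalfPlane.ofComplex (((z : ℂ) + b) / p))) +
      χ (p : ZMod 1951) * u (UpperHalfPlane.ofComplex ((p : ℂ) * z)))

/-- **The closed conclusion of the crux**: an order-5 `χ mod 1951` and a non-zero `λ = 1/4`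
weight-0 Maass cusp form on `(Γ₀(1951), χ)` with the exact icosahedral fingerprint at `p ≤ 13`. -/
def MaassWitness : Prop :=
  ∃ χ : DirichletCharacter ℂ 1951, orderOf χ = 5 ∧ ∃ u : UpperHalfPlane → ℂ, IsForm χ u (1 / 4) ∧
    (∃ z, u z ≠ 0) ∧ ∀ p ∈ P₀, ∃ μ φ : ℂ, φ ∈ Φ ∧ (∀ z, Tp χ p u z = μ * u z) ∧
      μ ^ 2 * (starRingEnd ℂ) (χ (p : ZMod 1951)) = φ

/-- The Galois-side hypotheses of the crux on `ρ` (irreducible, finite image, even, conductor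
`1951`, order-5 determinant and icosahedral Frobenius data away from `1951`). -/
def GaloisSide (ℓ : ℕ) [Fact ℓ.Prime] (ι : PadicAlgCl ℓ ≃+* ℂ)
    (ρ : FramedGaloisRep ℚ (PadicAlgCl ℓ) 2) : Prop :=
  ρ.toGaloisRep.IsIrreducible ∧ (Set.range ρ).Finite ∧ ρ.IsEven ∧
    ρ.toGaloisRep.artinConductorNat = 1951 ∧
    ∃ χ₀ : DirichletCharacter ℂ 1951, orderOf χ₀ = 5 ∧
      ∀ v : IsDedekindDomain.HeightOneSpectrum (NumberField.RingOfIntegers ℚ),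
        v.residueCard ≠ 1951 → ρ.IsUnramifiedAt v ∧ ∃ t d : PadicAlgCl ℓ,
          ρ.HasFrobCharpolyAt v
              (Polynomial.X ^ 2 - Polynomial.C t * Polynomial.X + Polynomial.C d) ∧
            ι d = (χ₀ (v.residueCard : ZMod 1951))⁻¹ ∧
            (t ^ 2 = 0 ∨ t ^ 2 = d ∨ t ^ 2 = 4 * d ∨ t ^ 4 - 3 * d * t ^ 2 + d ^ 2 = 0)

/-- **An instance of the hypotheses**: some reciprocity data, `ℓ ≥ 17`, `ℓ ≠ 1951`, `ι`, a
cuspidal L-algebraic `π` and a `ρ` on the Galois side which correspond at all places. -/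
def HypInstance : Prop :=
  ∃ (RD : ReciprocityData ℚ) (ℓ : ℕ) (_ : Fact ℓ.Prime) (ι : PadicAlgCl ℓ ≃+* ℂ)
    (hcpt : isCompact_glFiniteIntegralLevel 2 ℚ) (π : CuspidalAutomorphicRepData 2 ℚ hcpt)
    (ρ : FramedGaloisRep ℚ (PadicAlgCl ℓ) 2),
    17 ≤ ℓ ∧ ℓ ≠ 1951 ∧ GaloisSide ℓ ι ρ ∧ π.1.IsLAlgebraic ∧ Corresponds RD ι π.1 ρ

/-! ## Finding 1: refutation normal form -/

/-- The crux is exactly "`HypInstance → MaassWitness`" (its conclusion is closed). -/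
theorem correspondentFingerprint_iff :
    CorrespondentFingerprint ↔ (HypInstance → MaassWitness) := by
  constructor
  · rintro h ⟨RD, ℓ, hℓ, ι, hcpt, π, ρ, h17, hne, hG, hL, hC⟩
    exact h RD ℓ ι hcpt π ρ h17 hne hG hL hC
  · intro h RD ℓ hℓ ι hcpt π ρ h17 hne hG hL hC
    exact h ⟨RD, ℓ, hℓ, ι, hcpt, π, ρ, h17, hne, hG, hL, hC⟩

/-- **Refutation normal form.** Any disproof of the crux must exhibit a full all-places
correspondent AND refute the existence of the fingerprinted `λ = 1/4` form. -/
theorem not_correspondentFingerprint_iff :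
    ¬ CorrespondentFingerprint ↔ (HypInstance ∧ ¬ MaassWitness) := by
  rw [correspondentFingerprint_iff, Classical.not_imp]

/-- The conclusion alone proves the crux (its hypotheses are not used by the conclusion). -/
theorem correspondentFingerprint_of_maassWitness (h : MaassWitness) : CorrespondentFingerprint :=
  correspondentFingerprint_iff.2 fun _ => h

/-- **Load-bearing analysis, in one line.** Every weakening of the hypotheses (any predicate
`Hyp⁻` whatsoever in place of `HypInstance`) is still implied by `MaassWitness`; so no
`_false_without_<H>` lemma exists unless `MaassWitness` itself is refuted. -/
theorem weakening_of_maassWitness (HypWeak : Prop) (h : MaassWitness) : HypWeak → MaassWitness :=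
  fun _ => h

/-! ## Finding 3: the conclusion kills the route's other crux -/

/-- `MaassWitness` refutes `QuarterFingerprintDeficit` (exact `λ = 1/4`, exact fingerprint ⊂
window `1/100`). -/
theorem maassWitness_not_quarterFingerprintDeficit (h : MaassWitness) :
    ¬ QuarterFingerprintDeficit := by
  intro hQ
  obtain ⟨χ, hχ, u, hform, hne, hfp⟩ := h
  refine hQ χ hχ ⟨u, 1 / 4, hform, hne, by norm_num, fun p hp => ?_⟩
  obtain ⟨μ, φ, hφ, hT, hμ⟩ := hfp p hp
  exact ⟨μ, φ, hφ, hT, by rw [hμ, sub_self, norm_zero]; norm_num⟩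

/-- **Modulo the route's bet, C2a is "no correspondent exists".** -/
theorem correspondentFingerprint_iff_noCorrespondent_of_deficit (hQ : QuarterFingerprintDeficit) :
    CorrespondentFingerprint ↔ ¬ HypInstance := by
  rw [correspondentFingerprint_iff]
  constructor
  · exact fun h hH => maassWitness_not_quarterFingerprintDeficit (h hH) hQ
  · exact fun h hH => (h hH).elim

/-- Equivalently: the two cruxes together say precisely `¬ HypInstance` (and the bet). -/
theorem deficit_and_correspondentFingerprint_iff :
    (QuarterFingerprintDeficit ∧ CorrespondentFingerprint) ↔
      (QuarterFingerprintDeficit ∧ ¬ HypInstance) :=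
  ⟨fun ⟨hQ, hC⟩ => ⟨hQ, (correspondentFingerprint_iff_noCorrespondent_of_deficit hQ).1 hC⟩,
    fun ⟨hQ, hN⟩ => ⟨hQ, (correspondentFingerprint_iff_noCorrespondent_of_deficit hQ).2 hN⟩⟩

/-! ## Finding 4: parity tightness of the conclusion -/

/-- `-1 ∈ Γ₀(1951)`. -/
theorem neg_one_mem_Gamma0 : (-1 : SL(2, ℤ)) ∈ CongruenceSubgroup.Gamma0 1951 := by
  simp [CongruenceSubgroup.Gamma0_mem]

/-- The weight-0 automorphy clause with an ODD nebentypus forces `u = 0`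
(`-1` acts trivially on `ℍ` and has `d`-entry `-1`). -/
theorem automorphy_odd_forces_zero (χ : DirichletCharacter ℂ 1951) (hχ : χ.Odd)
    (u : UpperHalfPlane → ℂ)
    (hu : ∀ γ : SL(2, ℤ), γ ∈ CongruenceSubgroup.Gamma0 1951 →
      ∀ z : UpperHalfPlane, u (γ • z) = χ ((γ 1 1 : ℤ) : ZMod 1951) * u z) :
    ∀ z, u z = 0 := by
  intro z
  have h := hu (-1) neg_one_mem_Gamma0 z
  rw [ModularGroup.SL_neg_smul, one_smul] at h
  have hd : (((-1 : SL(2, ℤ)) 1 1 : ℤ) : ZMod 1951) = -1 := by simp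
  rw [hd, hχ] at h
  -- h : u z = -1 * u z
  have : (2 : ℂ) * u z = 0 := by linear_combination h
  simpa using this

/-- The odd-nebentypus twin of the conclusion (same `IsForm`, `χ` odd instead of order 5). -/
def MaassWitnessOdd : Prop :=
  ∃ χ : DirichletCharacter ℂ 1951, χ.Odd ∧ ∃ u : UpperHalfPlane → ℂ, ∃ lam : ℝ,
    IsForm χ u lam ∧ ∃ z, u z ≠ 0

/-- **Small-model refutation of the odd twin**: no non-zero weight-0 form with odd nebentypus. -/
theorem not_maassWitnessOdd : ¬ MaassWitnessOdd := by
  rintro ⟨χ, hχ, u, lam, hform, z, hz⟩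
  exact hz (automorphy_odd_forces_zero χ hχ u hform.2.2.1 z)

/-- Order-5 Dirichlet characters are even (so the conclusion's `∃ χ` is parity-consistent). -/
theorem even_of_orderOf_eq_five (χ : DirichletCharacter ℂ 1951) (h : orderOf χ = 5) : χ.Even := by
  rcases χ.even_or_odd with he | ho
  · exact he
  · exfalso
    have h5 : χ ^ 5 = 1 := by rw [← h]; exact pow_orderOf_eq_one χ
    have key : (χ ^ 5) (-1) = χ (-1) ^ 5 := MulChar.pow_apply' χ (by norm_num) (-1)
    rw [h5, ho] at key
    have h1 : (1 : DirichletCharacter ℂ 1951) (-1 : ZMod 1951) = 1 :=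
      MulChar.one_apply (isUnit_one.neg)
    rw [h1] at key
    norm_num at key

/-- In the conclusion, the witnessing character is necessarily even (from `u ≠ 0`). -/
theorem maassWitness_character_even {χ : DirichletCharacter ℂ 1951} {u : UpperHalfPlane → ℂ}
    {lam : ℝ} (hform : IsForm χ u lam) (hne : ∃ z, u z ≠ 0) : χ.Even := by
  rcases χ.even_or_odd with he | ho
  · exact he
  · obtain ⟨z, hz⟩ := hne
    exact (hz (automorphy_odd_forces_zero χ ho u hform.2.2.1 z)).elim

end Summit.Langlands.Langlands.Cruxes.CorrespondentFingerprint.Disproof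

end
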